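import Summits.NavierStokesRegularity.NavierStokesRegularity.Theorems.StrainDoorsAlmostDefs
import Summits.NavierStokesRegularity.NavierStokesRegularity.Theorems.StrainDoorsCompositionsB
import HarnessLib

/-!
# StrainDoorsAlmostCompositions — doors S37-H♭/Π♭ from the plates (§6♭–§8♭ of nsreg-p1 g31's `r35/Sketch37b.lean`
# sha16 d674839b8ebfbacc, l.389–716 VERBATIM)

`strainFeedingDoorAlmost_of` (two-slab barrier with the device's allowance), `pressureFocusingDoorAlmost_of` (Poisson),
`strainThresholdAlmost_of`, `strainThresholdAlmostLinear_holds` (BY NAME over LEAD's p658095 `ArgmaxDoors.strainThresholdAlmost`),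
`strainThresholdAlmost_holds`, and the doors modulo the ONE open plate E1_S♭: `strainFeedingDoorAlmost_of_plates`,
`pressureFocusingDoorAlmost_of_plates : StrainGrowthWeighted → …`.  Texts in `…StrainDoorsAlmostDefs`; F_S / PoissonTrace
closers from `…StrainDoorsCompositionsB`.  Landed by ns-s29-p2 g4 on LEAD ns-s30-p1 g3's key 2026-08-28T18:53:38Z (c),
`--supports stmt-NavierStokesRegularity-0056 --as helper`.

HONEST FRAME: regularity CRITERIA about hypothetical blow-up; H♭/Π♭ close by one-line appends once E1_S♭
`strainGrowthWeighted_holds` (ns-sfl-p1 g5) lands; item 0056 `NoTypeII` and NS regularity are NOT proved.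
-/

noncomputable section

open MeasureTheory Set Function Filter Metric Real InnerProductSpace
open _root_.Topology
open scoped ENNReal NNReal RealInnerProductSpace ContDiff Laplacian
open Literature.Analysis Literature.Analysis.FluidPDE
open Literature.Analysis.FluidPDE.VorticityDirectionDynamics

set_option linter.dupNamespace false

namespace Summit.NavierStokesRegularity.NavierStokesRegularity.Theorems.StrainDoors

open Summit.NavierStokesRegularity.NavierStokesRegularity.Theorems.ArgmaxDoors

-- nested operator types (second derivatives)
set_option maxSynthPendingDepth 3
/-! ## §6♭ Door S37-H♭ from the plates (the same two-slab barrier, allowance absorbed by the device) -/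

/-- **Door S37-H♭ from the plates**: `StrainGrowthWeighted → StrainFrame → StrainThresholdAlmost →
SubcriticalStrainDoor → StrainFeedingDoorAlmost`. Identical to `strainFeedingDoor_of` (log barrier on `[t₀,τ]`,
constant barrier `y₀/(T−t)` on `[τ,t₂]`, then door Λ), except that the growth inequality is discharged at the
device's PENALISED almost-maximisers: E1_S♭ gives `∂ₜq ≤ −q² + H + (6νε + √ε|u(t,x̄)|)q`, the door hypothesis
bounds `(T−t)²H ≤ c` there (they are `(1−δ)`-almost maximisers above the line), and `|u| ≤ K₀` on `[0,t₂]`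
(frame) makes the allowance `η(ε)q`, `η(ε) = 6νε + √εK₀ → 0`. [folklore] -/
theorem strainFeedingDoorAlmost_of (hG : StrainGrowthWeighted) (hFr : StrainFrame) (hTh : StrainThresholdAlmost)
    (hΛ : SubcriticalStrainDoor) : StrainFeedingDoorAlmost := by
  intro ν T t₀ y₀ c δ hν ht₀ ht₀T hy₀ hy₀1 hc hδ hδ1 u p hsol hreg hhyp
  -- WLOG `0 ≤ c` (replace `c` by `max c 0 < y₀(1+y₀)`)
  wlog hc0 : 0 ≤ c generalizing c with Hwlog
  · exact Hwlog (max c 0) (max_lt hc (by positivity))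
      (fun t ht x e halm hbig => (hhyp t ht x e halm hbig).trans (le_max_left _ _)) (le_max_right _ _)
  have hT : 0 < T := lt_of_le_of_lt ht₀ ht₀T
  have hTt₀ : 0 < T - t₀ := sub_pos.2 ht₀T
  -- ### Step 0♭: the Riccati inequality with allowance at the charged penalised almost-maximisers
  have hgrowth : ∀ (K₀ t₂ : ℝ), t₂ < T → (∀ t ∈ Icc 0 t₂, ∀ x : EuclideanSpace ℝ (Fin 3), ‖u t x‖ ≤ K₀) →
      ∀ ε : ℝ, 0 < ε → ∀ t ∈ Ico t₀ T, t ≤ t₂ → ∀ (x e : EuclideanSpace ℝ (Fin 3)), ‖e‖ = 1 →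
      (∀ (y e' : EuclideanSpace ℝ (Fin 3)), ‖e'‖ = 1 →
        (1 + ε * ‖y‖ ^ 2)⁻¹ * strainQuad u t y e' ≤ (1 + ε * ‖x‖ ^ 2)⁻¹ * strainQuad u t x e) →
      (∀ (y e' : EuclideanSpace ℝ (Fin 3)), ‖e'‖ = 1 → (1 - δ) * strainQuad u t y e' ≤ strainQuad u t x e) →
      y₀ < (T - t) * strainQuad u t x e → 0 ≤ strainQuad u t x e →
      strainRate T u t x e ≤ -(strainQuad u t x e) ^ 2 + c / (T - t) ^ 2 +
        (6 * ν * ε + Real.sqrt ε * K₀) * strainQuad u t x e := by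
    intro K₀ t₂ ht₂T hK₀ ε hε t ht htt₂ x e he hpen halm hbig hq0
    have ht' : t ∈ Ico 0 T := ⟨ht₀.trans ht.1, ht.2⟩
    have hTt : 0 < T - t := sub_pos.2 ht.2
    have hsm : ContDiff ℝ ∞ (u t) := hsol.smooth_velocity.contDiff_slice ht'
    have heq := hFr ν T hν hT u p hsol t ht' x e
    have hE := hG ν ε hν.le hε (u t) (p t) hsm x e he (fun y => hpen y e he) hq0 _ heq
    have hfeed := hhyp t ht x e ⟨he, halm⟩ hbig
    have hfeed' : strainFeed u p t x e ≤ c / (T - t) ^ 2 := by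
      rw [le_div_iff₀ (by positivity)]
      linarith [hfeed]
    have hux : ‖u t x‖ ≤ K₀ := hK₀ t ⟨ht'.1, htt₂⟩ x
    have hallow : (6 * ν * ε + Real.sqrt ε * ‖u t x‖) * strainQuad u t x e ≤
        (6 * ν * ε + Real.sqrt ε * K₀) * strainQuad u t x e := by
      apply mul_le_mul_of_nonneg_right _ hq0
      have := mul_le_mul_of_nonneg_left hux (Real.sqrt_nonneg ε)
      linarith
    have h1 : strainRate T u t x e ≤ -(strainQuad u t x e) ^ 2 + strainFeed u p t x e +
        (6 * ν * ε + Real.sqrt ε * ‖u t x‖) * strainQuad u t x e := by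
      unfold strainRate strainQuad strainFeed pressureHess
      linarith [hE]
    linarith
  -- the allowance `η(ε) = 6νε + √ε·K₀ → 0`
  have hηlim : ∀ K₀ : ℝ, Tendsto (fun ε : ℝ => 6 * ν * ε + Real.sqrt ε * K₀) (𝓝[>] 0) (𝓝 0) := by
    intro K₀
    have hc : Continuous fun ε : ℝ => 6 * ν * ε + Real.sqrt ε * K₀ :=
      (continuous_const.mul continuous_id).add (Real.continuous_sqrt.mul continuous_const)
    have h := hc.tendsto 0
    simp only [mul_zero, Real.sqrt_zero, zero_mul, add_zero] at h
    exact tendsto_nhdsWithin_of_tendsto_nhds h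
  -- slab sup of `|u|` on `[0, t₂]`, `t₂ < T`
  have hK : ∀ t₂ : ℝ, 0 < t₂ → t₂ < T →
      ∃ K₀ : ℝ, 0 ≤ K₀ ∧ ∀ t ∈ Icc 0 t₂, ∀ x : EuclideanSpace ℝ (Fin 3), ‖u t x‖ ≤ K₀ := by
    intro t₂ ht₂0 ht₂T
    have hS : IsClassicalNSSolutionOn (Icc 0 t₂) ν 0 u p :=
      hsol.mono (Icc_subset_Ico_right ht₂T) (uniqueDiffOn_Icc ht₂0)
    exact exists_forall_norm_le_of_hasBoundedSobolevNormsOn hS (hreg t₂ ht₂T)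
  -- ### Step 1: a bound for the strain form at time `t₀`
  obtain ⟨M, hM0, hM⟩ : ∃ M : ℝ, 0 ≤ M ∧
      ∀ (x e : EuclideanSpace ℝ (Fin 3)), ‖e‖ = 1 → strainQuad u t₀ x e ≤ M := by
    set T'' : ℝ := (t₀ + T) / 2 with hT''
    have hT''T : T'' < T := by rw [hT'']; linarith
    have ht₀T'' : t₀ ≤ T'' := by rw [hT'']; linarith
    have hT''0 : 0 < T'' := by rw [hT'']; linarith
    have hS : IsClassicalNSSolutionOn (Icc 0 T'') ν 0 u p :=
      hsol.mono (Icc_subset_Ico_right hT''T) (uniqueDiffOn_Icc hT''0)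
    have hBn : HasBoundedSobolevNormsOn (Icc 0 T'') u := hreg T'' hT''T
    obtain ⟨B₁, B₂, hB₁, -, hpk⟩ := IntenseSetDoors.slice_package hS hBn
    refine ⟨B₁, hB₁, fun x e he => ?_⟩
    obtain ⟨-, -, -, -, -, hgrad, -⟩ := hpk t₀ ⟨ht₀, ht₀T''⟩
    calc strainQuad u t₀ x e ≤ ‖fderiv ℝ (u t₀) x e‖ * ‖e‖ := real_inner_le_norm _ _
      _ ≤ ‖fderiv ℝ (u t₀) x‖ * ‖e‖ * ‖e‖ := by
          gcongr
          exact ContinuousLinearMap.le_opNorm _ _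
      _ ≤ B₁ := by rw [he, mul_one, mul_one]; exact hgrad x
  -- ### Step 2: constants of the two-slab barrier
  have hgap : 0 < y₀ ^ 2 + y₀ - c := by nlinarith [hc]
  set κ : ℝ := (y₀ ^ 2 + y₀ - c) / 2 with hκ
  have hκ0 : 0 < κ := by rw [hκ]; linarith [hgap]
  set Y : ℝ := y₀ + (T - t₀) * M + 1 with hY
  have hYy₀ : y₀ < Y := by have := mul_nonneg hTt₀.le hM0; rw [hY]; linarith
  have hY0 : 0 < Y := hy₀.trans hYy₀
  -- the Riccati margin: `c + κ ≤ y + y²` for `y ≥ y₀`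
  have hquad : ∀ y : ℝ, y₀ ≤ y → c + κ ≤ y + y ^ 2 := by
    intro y hy
    have h1 : c + κ ≤ y₀ + y₀ ^ 2 := by rw [hκ]; nlinarith [hc]
    have h2 : 0 ≤ (y - y₀) * (y + y₀ + 1) := mul_nonneg (sub_nonneg.2 hy) (by linarith)
    nlinarith
  -- `ρ = e^{−(Y − y₀)/κ} ∈ (0,1)`, `τ = T − (T − t₀)ρ`
  set ρ : ℝ := Real.exp (-((Y - y₀) / κ)) with hρ
  have hρ0 : 0 < ρ := Real.exp_pos _
  have hρ1 : ρ < 1 := by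
    have h : Real.exp (-((Y - y₀) / κ)) < Real.exp 0 :=
      Real.exp_lt_exp.2 (by have := div_pos (sub_pos.2 hYy₀) hκ0; linarith)
    rwa [Real.exp_zero] at h
  have hlogρ : Real.log ρ = -((Y - y₀) / κ) := by rw [hρ, Real.log_exp]
  set τ : ℝ := T - (T - t₀) * ρ with hτ
  have hTτ : T - τ = (T - t₀) * ρ := by rw [hτ]; ring
  have hTτ0 : 0 < T - τ := by rw [hTτ]; exact mul_pos hTt₀ hρ0
  have ht₀τ : t₀ < τ := by
    have : (T - t₀) * ρ < (T - t₀) * 1 := mul_lt_mul_of_pos_left hρ1 hTt₀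
    rw [hτ]; linarith
  have hτT : τ < T := by linarith
  have hτ0 : 0 ≤ τ := ht₀.trans ht₀τ.le
  -- ### Step 3: slab 1, `[t₀, τ]`, barrier `B₁ = (C₀ + κ log (T − t)) / (T − t)`
  set C₀ : ℝ := Y - κ * Real.log (T - t₀) with hC₀
  set Bf : ℝ → ℝ := fun t => (C₀ + κ * Real.log (T - t)) / (T - t) with hBf
  set Bf' : ℝ → ℝ := fun t => (C₀ + κ * Real.log (T - t) - κ) / (T - t) ^ 2 with hBf'
  set hf : ℝ → ℝ := fun t => c / (T - t) ^ 2 with hhf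
  -- the numerator `y(t) = C₀ + κ log (T − t)` stays `≥ y₀` on `[t₀, τ]` and equals `y₀` at `τ`
  have hyτ : C₀ + κ * Real.log (T - τ) = y₀ := by
    rw [hTτ, Real.log_mul hTt₀.ne' hρ0.ne', hlogρ, hC₀, mul_add, mul_neg, mul_div_cancel₀ _ hκ0.ne']
    ring
  have hyge : ∀ t ∈ Icc t₀ τ, y₀ ≤ C₀ + κ * Real.log (T - t) := by
    intro t ht
    have hTt : 0 < T - t := by linarith [ht.2]
    have hlog : Real.log (T - τ) ≤ Real.log (T - t) := Real.log_le_log hTτ0 (by linarith [ht.2])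
    have := mul_le_mul_of_nonneg_left hlog hκ0.le
    linarith [hyτ]
  have hslab1 : ∀ t ∈ Icc t₀ τ, ∀ (x e : EuclideanSpace ℝ (Fin 3)), ‖e‖ = 1 →
      strainQuad u t x e ≤ Bf t := by
    have hBc : ContinuousOn Bf (Icc t₀ τ) := by
      have h1 : ContinuousOn (fun t : ℝ => T - t) (Icc t₀ τ) := continuousOn_const.sub continuousOn_id
      have hne : ∀ t ∈ Icc t₀ τ, T - t ≠ 0 := fun t ht => by
        have : t ≤ τ := ht.2; exact (show (0:ℝ) < T - t by linarith).ne'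
      have h2 : ContinuousOn (fun t : ℝ => C₀ + κ * Real.log (T - t)) (Icc t₀ τ) :=
        continuousOn_const.add (continuousOn_const.mul (h1.log hne))
      exact h2.div h1 hne
    have hBpos : ∀ t ∈ Icc t₀ τ, 0 < Bf t := by
      intro t ht
      have hTt : 0 < T - t := by linarith [ht.2]
      exact div_pos (hy₀.trans_le (hyge t ht)) hTt
    have hBd : ∀ t ∈ Icc t₀ τ, HasDerivWithinAt Bf (Bf' t) (Icc t₀ τ) t := by
      intro t ht
      have hTt : 0 < T - t := by linarith [ht.2]
      have hlin : HasDerivAt (fun r : ℝ => T - r) (-1) t := by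
        simpa using (hasDerivAt_id t).const_sub T
      have hlog : HasDerivAt (fun r : ℝ => Real.log (T - r)) ((-1) / (T - t)) t := hlin.log hTt.ne'
      have hnum : HasDerivAt (fun r : ℝ => C₀ + κ * Real.log (T - r)) (0 + κ * ((-1) / (T - t))) t :=
        (hasDerivAt_const t C₀).add (hlog.const_mul κ)
      have hquot := hnum.div hlin hTt.ne'
      have hTt' : T - t ≠ 0 := hTt.ne'
      refine (hquot.congr_deriv ?_).hasDerivWithinAt
      simp only [hBf']
      field_simp
      ring
    have hsuper : ∀ t ∈ Icc t₀ τ, -(Bf t) ^ 2 + hf t ≤ Bf' t := by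
      intro t ht
      have hTt : 0 < T - t := by linarith [ht.2]
      have hy := hquad _ (hyge t ht)
      simp only [hBf, hBf', hhf]
      rw [div_pow]
      have h1 : -((C₀ + κ * Real.log (T - t)) ^ 2 / (T - t) ^ 2) + c / (T - t) ^ 2 =
          (c - (C₀ + κ * Real.log (T - t)) ^ 2) / (T - t) ^ 2 := by ring
      rw [h1, div_le_div_iff_of_pos_right (by positivity)]
      linarith [hy]
    obtain ⟨K₀, -, hK₀⟩ := hK τ (ht₀.trans_lt ht₀τ) hτT
    have hrate : ∀ ε : ℝ, 0 < ε → ε ≤ 1 → ∀ t ∈ Ioc t₀ τ, ∀ (x e : EuclideanSpace ℝ (Fin 3)), ‖e‖ = 1 →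
        (∀ (y e' : EuclideanSpace ℝ (Fin 3)), ‖e'‖ = 1 →
          (1 + ε * ‖y‖ ^ 2)⁻¹ * strainQuad u t y e' ≤ (1 + ε * ‖x‖ ^ 2)⁻¹ * strainQuad u t x e) →
        (∀ (y e' : EuclideanSpace ℝ (Fin 3)), ‖e'‖ = 1 → (1 - δ) * strainQuad u t y e' ≤ strainQuad u t x e) →
        Bf t < strainQuad u t x e → strainRate T u t x e ≤ -(strainQuad u t x e) ^ 2 + hf t +
          (6 * ν * ε + Real.sqrt ε * K₀) * strainQuad u t x e := by
      intro ε hε _ t ht x e he hpen halm hbig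
      have hTt : 0 < T - t := by linarith [ht.2]
      have htI : t ∈ Ico t₀ T := ⟨ht.1.le, by linarith [ht.2]⟩
      have hy := hyge t ⟨ht.1.le, ht.2⟩
      have hline : y₀ < (T - t) * strainQuad u t x e := by
        have h1 : (T - t) * Bf t = C₀ + κ * Real.log (T - t) := by
          simp only [hBf]; rw [mul_div_cancel₀ _ hTt.ne']
        have h2 : (T - t) * Bf t < (T - t) * strainQuad u t x e := mul_lt_mul_of_pos_left hbig hTt
        linarith
      have hq0 : 0 ≤ strainQuad u t x e := ((hBpos t ⟨ht.1.le, ht.2⟩).trans hbig).le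
      exact hgrowth K₀ τ hτT hK₀ ε hε t htI ht.2 x e he hpen halm hline hq0
    have hinit : ∀ (x e : EuclideanSpace ℝ (Fin 3)), ‖e‖ = 1 → strainQuad u t₀ x e ≤ Bf t₀ := by
      intro x e he
      have h1 : Bf t₀ = Y / (T - t₀) := by simp only [hBf, hC₀]; ring
      rw [h1, le_div_iff₀ hTt₀]
      have h2 := hM x e he
      have h3 : strainQuad u t₀ x e * (T - t₀) ≤ M * (T - t₀) := mul_le_mul_of_nonneg_right h2 hTt₀.le
      rw [hY]; nlinarith
    exact hTh ν T t₀ τ δ _ hν ht₀ ht₀τ hτT hδ hδ1 (hηlim K₀) u p hsol hreg Bf Bf' hf hBc hBpos hBd hsuper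
      (fun t _ => div_nonneg hc0 (sq_nonneg _)) hrate hinit
  -- the value at `τ`: `⟪∇u(τ,x)e,e⟫ ≤ y₀ / (T − τ)`
  have hatτ : ∀ (x e : EuclideanSpace ℝ (Fin 3)), ‖e‖ = 1 → strainQuad u τ x e ≤ y₀ / (T - τ) := by
    intro x e he
    have h := hslab1 τ ⟨ht₀τ.le, le_rfl⟩ x e he
    simp only [hBf] at h
    rwa [hyτ] at h
  -- ### Step 4: slab 2, `[τ, t₂]` for every `t₂ < T`, barrier `B₂ = y₀ / (T − t)`
  have hslab2 : ∀ t ∈ Ico τ T, ∀ (x e : EuclideanSpace ℝ (Fin 3)), ‖e‖ = 1 →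
      (T - t) * strainQuad u t x e ≤ y₀ := by
    intro t ht x e he
    set t₂ : ℝ := (t + T) / 2 with ht₂
    have hτt₂ : τ < t₂ := by rw [ht₂]; linarith [ht.1, ht.2]
    have ht₂T : t₂ < T := by rw [ht₂]; linarith [ht.2]
    have htt₂ : t ≤ t₂ := by rw [ht₂]; linarith [ht.2]
    set B₂ : ℝ → ℝ := fun s => y₀ / (T - s) with hB₂
    set B₂' : ℝ → ℝ := fun s => y₀ / (T - s) ^ 2 with hB₂'
    set h₂ : ℝ → ℝ := fun s => c / (T - s) ^ 2 with hh₂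
    have hpos : ∀ s ∈ Icc τ t₂, 0 < T - s := fun s hs => by linarith [hs.2]
    have hBc : ContinuousOn B₂ (Icc τ t₂) :=
      continuousOn_const.div (continuousOn_const.sub continuousOn_id) fun s hs => (hpos s hs).ne'
    have hBpos : ∀ s ∈ Icc τ t₂, 0 < B₂ s := fun s hs => div_pos hy₀ (hpos s hs)
    have hBd : ∀ s ∈ Icc τ t₂, HasDerivWithinAt B₂ (B₂' s) (Icc τ t₂) s := by
      intro s hs
      have hTs := hpos s hs
      have hlin : HasDerivAt (fun r : ℝ => T - r) (-1) s := by
        simpa using (hasDerivAt_id s).const_sub T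
      have hquot := (hasDerivAt_const s y₀).div hlin hTs.ne'
      have hTs' : T - s ≠ 0 := hTs.ne'
      refine (hquot.congr_deriv ?_).hasDerivWithinAt
      simp only [hB₂']
      field_simp
      ring
    have hsuper : ∀ s ∈ Icc τ t₂, -(B₂ s) ^ 2 + h₂ s ≤ B₂' s := by
      intro s hs
      have hTs := hpos s hs
      simp only [hB₂, hB₂', hh₂]
      rw [div_pow]
      have hc' : c ≤ y₀ + y₀ ^ 2 := by nlinarith
      have h1 : -(y₀ ^ 2 / (T - s) ^ 2) + c / (T - s) ^ 2 = (c - y₀ ^ 2) / (T - s) ^ 2 := by ring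
      rw [h1, div_le_div_iff_of_pos_right (by positivity)]
      linarith
    obtain ⟨K₀, -, hK₀⟩ := hK t₂ ((ht₀.trans_lt ht₀τ).trans hτt₂) ht₂T
    have hrate : ∀ ε : ℝ, 0 < ε → ε ≤ 1 → ∀ s ∈ Ioc τ t₂, ∀ (x e : EuclideanSpace ℝ (Fin 3)), ‖e‖ = 1 →
        (∀ (y e' : EuclideanSpace ℝ (Fin 3)), ‖e'‖ = 1 →
          (1 + ε * ‖y‖ ^ 2)⁻¹ * strainQuad u s y e' ≤ (1 + ε * ‖x‖ ^ 2)⁻¹ * strainQuad u s x e) →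
        (∀ (y e' : EuclideanSpace ℝ (Fin 3)), ‖e'‖ = 1 → (1 - δ) * strainQuad u s y e' ≤ strainQuad u s x e) →
        B₂ s < strainQuad u s x e → strainRate T u s x e ≤ -(strainQuad u s x e) ^ 2 + h₂ s +
          (6 * ν * ε + Real.sqrt ε * K₀) * strainQuad u s x e := by
      intro ε hε _ s hs x' e' he hpen halm hbig
      have hTs : 0 < T - s := by linarith [hs.2]
      have hsI : s ∈ Ico t₀ T := ⟨(ht₀τ.trans hs.1).le, by linarith [hs.2]⟩
      have hline : y₀ < (T - s) * strainQuad u s x' e' := by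
        have h1 : (T - s) * B₂ s = y₀ := by simp only [hB₂]; rw [mul_div_cancel₀ _ hTs.ne']
        have h2 : (T - s) * B₂ s < (T - s) * strainQuad u s x' e' := mul_lt_mul_of_pos_left hbig hTs
        linarith
      have hq0 : 0 ≤ strainQuad u s x' e' := ((hBpos s ⟨hs.1.le, hs.2⟩).trans hbig).le
      exact hgrowth K₀ t₂ ht₂T hK₀ ε hε s hsI hs.2 x' e' he hpen halm hline hq0
    have hinit : ∀ (x e : EuclideanSpace ℝ (Fin 3)), ‖e‖ = 1 → strainQuad u τ x e ≤ B₂ τ := by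
      intro x' e' he'
      simp only [hB₂]
      exact hatτ x' e' he'
    have hmain := hTh ν T τ t₂ δ _ hν hτ0 hτt₂ ht₂T hδ hδ1 (hηlim K₀) u p hsol hreg B₂ B₂' h₂ hBc hBpos hBd
      hsuper (fun s _ => div_nonneg hc0 (sq_nonneg _)) hrate hinit
    have h := hmain t ⟨ht.1, htt₂⟩ x e he
    have hTt : 0 < T - t := sub_pos.2 ht.2
    simp only [hB₂] at h
    rw [le_div_iff₀ hTt] at h
    linarith
  -- ### Step 5: door Λ on `[τ, T)`
  exact hΛ ν T τ y₀ hν hτ0 hτT hy₀1 u p hsol hreg hslab2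

/-! ## §7♭ Door S37-Π♭ from door S37-H♭ and the Poisson equation -/

/-- **Door S37-Π♭ from door S37-H♭**: `PoissonTrace → StrainFeedingDoorAlmost → PressureFocusingDoorAlmost`
(the pointwise identity of `pressureFocusingDoor_of`, verbatim). [folklore] -/
theorem pressureFocusingDoorAlmost_of (hP : PoissonTrace) (hH : StrainFeedingDoorAlmost) :
    PressureFocusingDoorAlmost := by
  intro ν T t₀ y₀ c δ hν ht₀ ht₀T hy₀ hy₀1 hc hδ hδ1 u p hsol hreg hhyp
  have hT : 0 < T := lt_of_le_of_lt ht₀ ht₀T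
  set t₁ : ℝ := (t₀ + T) / 2 with ht₁
  have ht₁0 : 0 < t₁ := by rw [ht₁]; linarith
  have ht₀t₁ : t₀ ≤ t₁ := by rw [ht₁]; linarith
  have ht₁T : t₁ < T := by rw [ht₁]; linarith
  refine hH ν T t₁ y₀ c δ hν ht₁0.le ht₁T hy₀ hy₀1 hc hδ hδ1 u p hsol hreg ?_
  intro t ht x e hax hbig
  have hPt := hP ν T hν hT u p hsol t ⟨ht₁0.trans_le ht.1, ht.2⟩ x
  have h := hhyp t ⟨ht₀t₁.trans ht.1, ht.2⟩ x e hax hbig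
  have hid : strainFeed u p t x e = (1 / 3) * strainNormSq u t x + (1 / 12) * ‖curl (u t) x‖ ^ 2 -
      (1 / 4) * ⟪curl (u t) x, e⟫ ^ 2 - devPressureHess p t x e := by
    rw [devPressureHess_eq p t x hax.1]
    unfold strainFeed strainNormSq pressureHess
    rw [hPt]
    ring
  rw [hid]
  exact h

/-! ## §8♭ E2_S♭ ⇐ E2_S♭-lin; doors H♭ / Π♭ from the open plates (NO decay plate) -/

/-- **E2_S♭ (Riccati form) from E2_S♭-lin**: `φ := −B + h/B`; `φB = −B² + h ≤ B'`; at a charged point with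
`q > B > 0`, `h ≥ 0`: `−q² + h + η(ε)q ≤ (φ + η(ε))q` since `φq − (−q² + h) = (q − B)(q + h/B) ≥ 0`. [folklore] -/
theorem strainThresholdAlmost_of (hL : StrainThresholdAlmostLinear) : StrainThresholdAlmost := by
  intro ν T t₁ t₂ δ η hν ht₁ ht₁₂ ht₂T hδ hδ1 hη u p hsol hreg B B' h hBc hBpos hBd hsuper hh0 hrate hinit
  refine hL ν T t₁ t₂ δ η hν ht₁ ht₁₂ ht₂T hδ hδ1 hη u p hsol hreg B B' (fun t => -B t + h t / B t) hBc hBpos hBd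
    ?_ ?_ hinit
  · intro t ht
    have hB := hBpos t ht
    have h1 : (-B t + h t / B t) * B t = -(B t) ^ 2 + h t := by
      have hB0 : B t ≠ 0 := hB.ne'
      rw [add_mul, div_mul_cancel₀ _ hB0]
      ring
    rw [h1]
    exact hsuper t ht
  · intro ε hε hε1 t ht x e he hpen halm hq
    have hB := hBpos t (Ioc_subset_Icc_self ht)
    have hh := hh0 t (Ioc_subset_Icc_self ht)
    have hq0 : 0 ≤ strainQuad u t x e := (hB.trans hq).le
    refine (hrate ε hε hε1 t ht x e he hpen halm hq).trans ?_
    rw [← sub_nonneg]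
    have h1 : (-B t + h t / B t + η ε) * strainQuad u t x e -
        (-(strainQuad u t x e) ^ 2 + h t + η ε * strainQuad u t x e) =
        (strainQuad u t x e - B t) * (strainQuad u t x e + h t / B t) := by
      have hB0 : B t ≠ 0 := hB.ne'
      have h2 : B t * (h t / B t) = h t := mul_div_cancel₀ _ hB0
      linear_combination h2
    rw [h1]
    exact mul_nonneg (sub_pos.2 hq).le (add_nonneg hq0 (div_nonneg hh hB.le))

/-- **Plate E2_S♭-lin «StrainThresholdAlmostLinear» CLOSED BY NAME** from the LEAD S-door's landed p658095
`ArgmaxDoors.strainThresholdAlmost` (`Theorems/StrainDoorsThresholdAlmost.lean`; the NS instance of p657155). -/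
theorem strainThresholdAlmostLinear_holds : StrainThresholdAlmostLinear :=
  strainThresholdAlmost

/-- **Plate E2_S♭ «StrainThresholdAlmost» CLOSED** (bridge + p658095). -/
theorem strainThresholdAlmost_holds : StrainThresholdAlmost :=
  strainThresholdAlmost_of strainThresholdAlmostLinear_holds

/-- **Door S37-H♭ from the ONE OPEN plate E1_S♭ «StrainGrowthWeighted»** — NO spatial-decay plate: F_S, door Λ,
E2_S♭ (over p658095) are closed. [folklore] -/
theorem strainFeedingDoorAlmost_of_plates (hG : StrainGrowthWeighted) : StrainFeedingDoorAlmost :=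
  strainFeedingDoorAlmost_of hG strainFrame_holds strainThresholdAlmost_holds subcriticalStrainDoor_holds

/-- **Door S37-Π♭ from the same single open plate** (PoissonTrace closed). [folklore] -/
theorem pressureFocusingDoorAlmost_of_plates (hG : StrainGrowthWeighted) : PressureFocusingDoorAlmost :=
  pressureFocusingDoorAlmost_of poissonTrace_holds (strainFeedingDoorAlmost_of_plates hG)

#print axioms pressureFocusingDoorAlmost_of_plates

end Summit.NavierStokesRegularity.NavierStokesRegularity.Theorems.StrainDoors

end
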